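import Mathlib
import Summits.Ventures.PercRepro2.Defs
import Summits.Ventures.PercRepro2.Independence
import Summits.Ventures.PercRepro2.Graph
import Summits.Ventures.PercRepro2.Exploration
import Summits.Ventures.PercRepro2.Induced
import Summits.Ventures.PercRepro2.HubModel
import Summits.Ventures.PercRepro2.HubModel3

/-!
# The a₃-hub law: a₃-bundle states ⊥ inner pattern, and the partition formula
(blind cell PercRepro2, mine-2 g15; MINE2-A3FIRST.md §3 — typer-1's `HubLaw` with the roles of
`a₃` and the roots exchanged)

The model graph of `HubModel3.lean` depends on the configuration only through
* the **a₃-bundle state** `a3State ends μ ω : Fin 4 → Bool` — which of the four a₃ bundles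
  `a₃o, a₃b, a₃a₁, a₃a₂` (`bundle3`) has an open edge, and
* the **inner pattern** `innerPat3 ends μ ω : Fin 6 → Bool` — which of the six pairs of the
  marks `o, a₁, a₂, b` (`ipair3`) is connected in `G′ = G − a₃`:
`modelGraph3 ends μ ω = modelGraphOf3 (a3State ends μ ω) (innerPat3 ends μ ω)`
(`modelGraph3_eq_modelGraphOf3`), where `modelGraphOf3 w π` is a computable graph on the five
marks (its reachability is decidable).

The a₃-bundle state is determined by the edges at `a₃` (`dependsOn_a3State`), the inner pattern by
the other edges (`dependsOn_innerPat3`), hence `P(W = w, Π = π) = P(W = w) · P(Π = π)`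
(`prob_a3State_inter_innerPat3`) and, for every event `{Φ(W, Π)}`,
`P(Φ(W, Π)) = Σ_w Σ_π 1[Φ(w, π)] · P(W = w) · P(Π = π)` (`prob_hubEvent3`) — the a₃-hub law of
MINE2-A3FIRST.md §3 with `P(Π = π)` the inner 4-mark law (the fifteen consistent patterns carry
all the mass) and `P(W = w)` the a₃-edge law (Bernstein form: the next file).
-/

namespace Summit.Ventures.PercRepro2.Hub3

open Hub

/-- The four a₃ bundles `(a₃, mark)`. -/
def bundle3 : Fin 4 → Mark × Mark
  | 0 => (.a₃, .o)
  | 1 => (.a₃, .b)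
  | 2 => (.a₃, .a₁)
  | 3 => (.a₃, .a₂)

/-- The six inner pairs among `o, a₁, a₂, b`. -/
def ipair3 : Fin 6 → Mark × Mark
  | 0 => (.o, .a₁)
  | 1 => (.o, .a₂)
  | 2 => (.o, .b)
  | 3 => (.a₁, .a₂)
  | 4 => (.a₁, .b)
  | 5 => (.a₂, .b)

/-- The first mark of every bundle is `a₃`. -/
lemma bundle3_fst_isA3 (i : Fin 4) : (bundle3 i).1.IsA3 := by
  fin_cases i <;> simp [bundle3, Mark.IsA3]

/-- The model adjacency table of a state pair `(w, π)`. -/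
def adjOf3 (w : Fin 4 → Bool) (π : Fin 6 → Bool) : Mark → Mark → Bool
  | .a₃, .o => w 0
  | .o, .a₃ => w 0
  | .a₃, .b => w 1
  | .b, .a₃ => w 1
  | .a₃, .a₁ => w 2
  | .a₁, .a₃ => w 2
  | .a₃, .a₂ => w 3
  | .a₂, .a₃ => w 3
  | .o, .a₁ => π 0
  | .a₁, .o => π 0
  | .o, .a₂ => π 1
  | .a₂, .o => π 1
  | .o, .b => π 2
  | .b, .o => π 2
  | .a₁, .a₂ => π 3
  | .a₂, .a₁ => π 3
  | .a₁, .b => π 4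
  | .b, .a₁ => π 4
  | .a₂, .b => π 5
  | .b, .a₂ => π 5
  | _, _ => false

/-- The model graph of a state pair (computable; reachability is decidable). -/
def modelGraphOf3 (w : Fin 4 → Bool) (π : Fin 6 → Bool) : SimpleGraph Mark :=
  SimpleGraph.fromRel (fun u v => adjOf3 w π u v = true)

/-- Adjacency in the model graph of a state pair is decidable. -/
instance (w : Fin 4 → Bool) (π : Fin 6 → Bool) : DecidableRel (modelGraphOf3 w π).Adj :=
  fun u v => decidable_of_iff _ (SimpleGraph.fromRel_adj _ u v).symm

variable {V : Type*} {E : Type*}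

section State

open Classical

variable (ends : E → Sym2 V) (μ : Mark → V) (ω : Config E)

/-- The a₃-bundle state: which a₃ bundles have an open edge. -/
noncomputable def a3State : Fin 4 → Bool :=
  fun i => decide (OpenAdj ends ω (μ (bundle3 i).1) (μ (bundle3 i).2))

/-- The inner pattern: which inner pairs are connected in `G′`. -/
noncomputable def innerPat3 : Fin 6 → Bool :=
  fun i => decide (Conn ends (innerConfig3 ends μ ω) (μ (ipair3 i).1) (μ (ipair3 i).2))

end State

section ModelEq

variable {ends : E → Sym2 V} {μ : Mark → V} {ω : Config E}

/-- Open adjacency is symmetric (iff form). -/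
lemma openAdj_comm {x y : V} : OpenAdj ends ω x y ↔ OpenAdj ends ω y x :=
  ⟨OpenAdj.symm, OpenAdj.symm⟩

/-- Connection is symmetric (iff form). -/
lemma conn_comm {ω' : Config E} {x y : V} : Conn ends ω' x y ↔ Conn ends ω' y x :=
  ⟨conn_symm, conn_symm⟩

/-- The model adjacency of `ω` is the adjacency table of its state pair (off the diagonal). -/
lemma modelAdj3_iff_adjOf3 {u v : Mark} (huv : u ≠ v) :
    modelAdj3 ends μ ω u v ↔ adjOf3 (a3State ends μ ω) (innerPat3 ends μ ω) u v = true := by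
  classical
  cases u <;> cases v <;>
    first
    | exact absurd rfl huv
    | (simp only [modelAdj3, adjOf3, a3State, innerPat3, bundle3, ipair3, Mark.IsA3,
        decide_eq_true_eq, reduceCtorEq, or_self, or_false, or_true, if_true, if_false] <;>
       first
       | exact Iff.rfl
       | exact openAdj_comm
       | exact conn_comm)

/-- **The model graph is a function of the state pair.** -/
theorem modelGraph3_eq_modelGraphOf3 :
    modelGraph3 ends μ ω = modelGraphOf3 (a3State ends μ ω) (innerPat3 ends μ ω) := by
  ext u v
  rw [modelGraph3, modelGraphOf3, SimpleGraph.fromRel_adj, SimpleGraph.fromRel_adj]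
  constructor
  · rintro ⟨huv, h | h⟩
    · exact ⟨huv, Or.inl ((modelAdj3_iff_adjOf3 huv).1 h)⟩
    · exact ⟨huv, Or.inr ((modelAdj3_iff_adjOf3 (Ne.symm huv)).1 h)⟩
  · rintro ⟨huv, h | h⟩
    · exact ⟨huv, Or.inl ((modelAdj3_iff_adjOf3 huv).2 h)⟩
    · exact ⟨huv, Or.inr ((modelAdj3_iff_adjOf3 (Ne.symm huv)).2 h)⟩

/-- **Five-mark connectivity in the class R₃ as a function of the state pair.** -/
theorem conn_iff_reachable_state3 (hinj : Function.Injective μ) (hR : ClassR3 ends μ) (u v : Mark) :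
    Conn ends ω (μ u) (μ v) ↔
      (modelGraphOf3 (a3State ends μ ω) (innerPat3 ends μ ω)).Reachable u v := by
  rw [conn_iff_modelReachable3 hinj hR, modelGraph3_eq_modelGraphOf3]

end ModelEq

section Independence

variable {ends : E → Sym2 V} {μ : Mark → V}

/-- Open adjacency at a vertex of `S` only looks at the edges touching `S`. -/
lemma openAdj_congr_touches {S : Set V} {ω ω' : Config E}
    (h : ∀ e ∈ touches ends S, ω e = ω' e) {x y : V} (hx : x ∈ S) :
    OpenAdj ends ω x y ↔ OpenAdj ends ω' x y := by
  constructor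
  · rintro ⟨e, he, hends⟩
    exact ⟨e, by rw [← h e ⟨x, hx, y, hends⟩]; exact he, hends⟩
  · rintro ⟨e, he, hends⟩
    exact ⟨e, by rw [h e ⟨x, hx, y, hends⟩]; exact he, hends⟩

/-- The inner configuration only looks at the edges not touching `a₃`. -/
lemma innerConfig3_congr {ω ω' : Config E}
    (h : ∀ e ∈ (touches ends {μ .a₃})ᶜ, ω e = ω' e) :
    innerConfig3 ends μ ω = innerConfig3 ends μ ω' := by
  funext e
  by_cases he : e ∈ touches ends {μ .a₃}
  · rw [innerConfig3, innerConfig3, delConfig_apply_of_mem he, delConfig_apply_of_mem he]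
  · rw [innerConfig3, innerConfig3, delConfig_apply_of_notMem he, delConfig_apply_of_notMem he,
      h e he]

/-- The a₃-bundle state is determined by the edges at `a₃`. -/
lemma dependsOn_a3State : DependsOn (a3State ends μ) (touches ends {μ .a₃}) := by
  intro ω ω' h
  funext i
  unfold a3State
  rw [openAdj_congr_touches h (a3_mem (bundle3_fst_isA3 i))]

/-- The inner pattern is determined by the edges not touching `a₃`. -/
lemma dependsOn_innerPat3 : DependsOn (innerPat3 ends μ) (touches ends {μ .a₃})ᶜ := by
  intro ω ω' h
  funext i
  unfold innerPat3
  rw [innerConfig3_congr h]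

variable [Fintype E] [DecidableEq E] {R : Type*} [CommRing R]

/-- **a₃ bundles ⊥ inner pattern**: `P(W = w, Π = π) = P(W = w) · P(Π = π)`. -/
theorem prob_a3State_inter_innerPat3 (p : E → R) (w : Fin 4 → Bool) (π : Fin 6 → Bool) :
    prob p ({ω | a3State ends μ ω = w} ∩ {ω | innerPat3 ends μ ω = π}) =
      prob p {ω | a3State ends μ ω = w} * prob p {ω | innerPat3 ends μ ω = π} := by
  classical
  refine prob_inter_eq_mul_of_dependsOn_compl p (touches ends {μ .a₃}) ?_ ?_
  · intro ω ω' h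
    show (a3State ends μ ω = w) = (a3State ends μ ω' = w)
    rw [dependsOn_a3State h]
  · intro ω ω' h
    show (innerPat3 ends μ ω = π) = (innerPat3 ends μ ω' = π)
    rw [dependsOn_innerPat3 h]

end Independence

section Partition

variable [Fintype E] [DecidableEq E] {R : Type*} [CommRing R]

/-- **Partition of an event by a statistic**: `P(A) = Σ_s P(A ∩ {f = s})`. -/
lemma prob_eq_sum_fiber3 (p : E → R) {S : Type*} [Fintype S] [DecidableEq S] (f : Config E → S)
    (A : Set (Config E)) : prob p A = ∑ s, prob p (A ∩ {ω | f ω = s}) := by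
  classical
  unfold prob
  rw [Finset.sum_comm]
  refine Finset.sum_congr rfl fun ω _ => ?_
  rw [Finset.sum_eq_single (f ω)]
  · by_cases hA : ω ∈ A
    · rw [Set.indicator_of_mem hA,
        Set.indicator_of_mem (show ω ∈ A ∩ {ω' | f ω' = f ω} from ⟨hA, rfl⟩)]
    · rw [Set.indicator_of_notMem hA, Set.indicator_of_notMem (fun h => hA h.1)]
  · intro s _ hs
    exact Set.indicator_of_notMem (fun h => hs h.2.symm) _
  · intro h
    exact absurd (Finset.mem_univ _) h

variable {ends : E → Sym2 V} {μ : Mark → V}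

/-- **The a₃-hub law**: the probability of an event determined by the state pair is the sum of
`P(W = w) · P(Π = π)` over the state pairs satisfying it. -/
theorem prob_hubEvent3 (p : E → R) (Φ : (Fin 4 → Bool) → (Fin 6 → Bool) → Prop)
    [∀ w π, Decidable (Φ w π)] :
    prob p {ω | Φ (a3State ends μ ω) (innerPat3 ends μ ω)} =
      ∑ w, ∑ π, if Φ w π then
        prob p {ω | a3State ends μ ω = w} * prob p {ω | innerPat3 ends μ ω = π} else 0 := by
  classical
  rw [prob_eq_sum_fiber3 p (fun ω => (a3State ends μ ω, innerPat3 ends μ ω)),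
    Fintype.sum_prod_type]
  refine Finset.sum_congr rfl fun w _ => Finset.sum_congr rfl fun π _ => ?_
  by_cases hΦ : Φ w π
  · rw [if_pos hΦ, ← prob_a3State_inter_innerPat3]
    congr 1
    ext ω
    simp only [Set.mem_inter_iff, Set.mem_setOf_eq, Prod.mk.injEq]
    constructor
    · rintro ⟨_, hw, hπ⟩
      exact ⟨hw, hπ⟩
    · rintro ⟨hw, hπ⟩
      exact ⟨by rw [hw, hπ]; exact hΦ, hw, hπ⟩
  · rw [if_neg hΦ]
    convert prob_empty p
    ext ω
    simp only [Set.mem_inter_iff, Set.mem_setOf_eq, Prod.mk.injEq, Set.mem_empty_iff_false,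
      iff_false, not_and]
    rintro h rfl rfl
    exact hΦ h

end Partition

end Summit.Ventures.PercRepro2.Hub3
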